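import Literature.MathematicalPhysics.KineticTheory.InfiniteChainFlowLocality

/-!
# Stub F `stub_pencilFramework` of line `gram-pencil-harmonic-chaos`, part F-L1: fixed-time locality
of the Buttà–Marchioro flow on a BOX of sites (deterministic half)
(crux `EmbeddedDrudeMourre.DrudeDissolution`, stmt-AtomisticToContinuum-12593; `--supports` file)

The tree's `InfiniteChainDynamics.exists_flow_sub_severedFlow_le` /
`exists_abs_sub_comp_severedFlow_le` (file `InfiniteChainFlowLocality`) approximate the time-`t` map
of a `𝒳₀`-dynamics by the severed dynamics `T^{Λ_{0,n}}_t` at the three sites `-1, 0, 1`, with the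
rate `(2 + 22 t K Q)(1/32)^{n-1}` on `{Q ≤ N}`. The rich zero-wavenumber datum of stub F needs the
same statement for observables reading an arbitrary box `[-k, k]` (local POLYNOMIALS of any range).
Buttà–Marchioro's estimate (3.14)–(3.16) is proved in the tree for every radius `k`
(`OscillatorChain.dist_limit_le`); this file re-runs the two packaging proofs of
`InfiniteChainFlowLocality` with `k` free, absorbing the `k`-dependence into the constants so that
the CONCLUSIONS HAVE LITERALLY THE SAME SHAPE as for `k = 1` (threshold `4 + A(1 + t²(1+t)Q) ≤ n`,
rate `(2 + 22 t K Q) 32^{-(n-1)}`), which lets the probabilistic half (`InfiniteChainL2Locality`) be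
re-run verbatim (part F-L2).

* `exists_flow_sub_severedFlow_le_box` — sites `|i| ≤ k`;
* `pencilFramework_localityA` (= `exists_abs_sub_comp_severedFlow_le` for observables polynomially
  Lipschitz in the coordinates of the box `[-k, k]`).
-/

noncomputable section

namespace Summit.AtomisticToContinuum.FouriersLaw.Theorems.DrudeDissolution.GramPencilHarmonicChaos

open MeasureTheory Filter Set Function Topology
open scoped InnerProductSpace ENNReal
open Literature.MathematicalPhysics.KineticTheory
open Literature.MathematicalPhysics.KineticTheory.HeatConduction
open Literature.MathematicalPhysics.KineticTheory.HeatConduction.OscillatorChain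

variable {P : OscillatorChain} {s₁ s₂ : ℕ}

/-- `(1/64)^{n+1-k} ≤ (1/32)^{n-1}` once `n ≥ 6k + 6`. [folklore] -/
theorem one_div_pow_le_of_le {k n : ℕ} (hn : 6 * k + 6 ≤ n) :
    ((1 : ℝ) / 64) ^ (n + 1 - k) ≤ (1 / 32) ^ (n - 1) := by
  have e64 : ((1 : ℝ) / 64) = (1 / 2) ^ 6 := by norm_num
  have e32 : ((1 : ℝ) / 32) = (1 / 2) ^ 5 := by norm_num
  rw [e64, e32, ← pow_mul, ← pow_mul]
  exact pow_le_pow_of_le_one (by norm_num) (by norm_num) (by omega)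

/-- `(1/32)^{n-k} ≤ 32^k (1/32)^{n-1}` for `k ≤ n`. [folklore] -/
theorem one_div_pow_sub_le (k n : ℕ) (hkn : k ≤ n) :
    ((1 : ℝ) / 32) ^ (n - k) ≤ 32 ^ k * (1 / 32) ^ (n - 1) := by
  have h1 : ((1 : ℝ) / 32) ^ (n - k) = 32 ^ k * (1 / 32) ^ n := by
    have e : (32 : ℝ) ^ k * (1 / 32) ^ k = 1 := by rw [← mul_pow]; norm_num
    calc ((1 : ℝ) / 32) ^ (n - k) = (1 / 32) ^ (n - k) * ((32 : ℝ) ^ k * (1 / 32) ^ k) := by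
          rw [e, mul_one]
      _ = 32 ^ k * (1 / 32) ^ (n - k + k) := by rw [pow_add]; ring
      _ = 32 ^ k * (1 / 32) ^ n := by rw [Nat.sub_add_cancel hkn]
  rw [h1]
  exact mul_le_mul_of_nonneg_left
    (pow_le_pow_of_le_one (by norm_num) (by norm_num) (Nat.sub_le n 1)) (by positivity)

/-- **Rate of convergence of the partial dynamics to a `𝒳₀`-dynamics at the sites of a box
`[-k, k]`** (BM (3.14)–(3.16) with `γ = 1`, `β' = 1`, centre `0`, radius `k`): there are `A ≥ k + 1`,
`K ≥ 0` with, for `σ ∈ 𝒳₀`, `t ≥ 0`, `n ≥ 4 + A(1 + t²(1+t) Q(σ))`, `|i| ≤ k` and `|s| ≤ t`,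
`|q_i(φ_s σ) - q_i(T^{Λ_{0,n}}_s σ)|, |p_i(φ_s σ) - p_i(T^{Λ_{0,n}}_s σ)| ≤ (2 + 22 t K Q(σ)) 32^{-(n-1)}`
(the `k`-dependence of BM's prefactors `64^{-(n+1-k)}`, `(2k+9) 32^{-(n-k)}` and of the threshold
`2k + 2 + …` is absorbed into `A` and `K`). [cite: ButtaMarchioro2016, §3 eqs. (3.14)–(3.16)] -/
theorem exists_flow_sub_severedFlow_le_box (D : InfiniteChainDynamics P) (hs₁ : 1 ≤ s₁) (hs₂ : 1 ≤ s₂)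
    (hU1 : IsEvenPolyOfDegree P.U s₁) (hV1 : IsEvenPolyOfDegree P.V s₂)
    (hcar : D.carrier = P.bmGood) (hB1 : P.CondB1) (k : ℕ) :
    ∃ A K : ℝ, (k : ℝ) + 1 ≤ A ∧ 0 ≤ K ∧ ∀ σ ∈ P.bmGood, ∀ t : ℝ, 0 ≤ t → ∀ n : ℕ,
      4 + A * (1 + t ^ 2 * (1 + t) * P.bmGrowth σ) ≤ n →
      ∀ i : ℤ, -(k : ℤ) ≤ i → i ≤ k → ∀ s : ℝ, |s| ≤ t →
        |(D.flow s σ i).1 - (severedFlow hB1 (Finset.Icc ((0 : ℤ) - n) ((0 : ℤ) + n)) s σ i).1| ≤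
            (2 + 22 * t * K * P.bmGrowth σ) * (1 / 32) ^ (n - 1) ∧
        |(D.flow s σ i).2 - (severedFlow hB1 (Finset.Icc ((0 : ℤ) - n) ((0 : ℤ) + n)) s σ i).2| ≤
            (2 + 22 * t * K * P.bmGrowth σ) * (1 / 32) ^ (n - 1) := by
  -- adapted from `InfiniteChainDynamics.exists_flow_sub_severedFlow_le` (radius `1` ↦ `k`)
  have hU0 : ∀ r, 0 ≤ P.U r := hU1.choose_spec.2.2
  have hV0 : ∀ r, 0 ≤ P.V r := hV1.choose_spec.2.2
  have hS1 : (1 : ℝ) ≤ ((max s₁ s₂ : ℕ) : ℝ) := by exact_mod_cast le_max_of_le_left hs₁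
  have hS0 : (0 : ℝ) < ((max s₁ s₂ : ℕ) : ℝ) := by linarith
  have hη1 : (((max s₁ s₂ : ℕ) : ℝ) - 1) / ((max s₁ s₂ : ℕ) : ℝ) < 1 := by
    rw [div_lt_one hS0]; linarith
  have hΦ : ∀ x ∈ P.bmGood, ∀ (s : ℝ) (i : ℤ),
      Tendsto (fun n : ℕ => severedFlow hB1 (Finset.Icc ((0 : ℤ) - n) ((0 : ℤ) + n)) s x i) atTop
        (𝓝 (D.flow s x i)) := fun x hx s i =>
    D.tendsto_severedFlow_flow hs₁ hs₂ hU1 hV1 hcar hB1 hx s 0 i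
  obtain ⟨A, K, hA1, hK0, h⟩ :=
    dist_limit_le hs₁ hs₂ hU1 hV1 hB1 hΦ (γ := 1) (β' := 1) hη1 one_lt_two one_pos
  refine ⟨A + 6 * k + 2, K * (2 * k + 9) * 32 ^ k, by linarith, by positivity,
    fun σ hσ t ht n hn i hi1 hi2 s hs => ?_⟩
  have hQ1 : 1 ≤ P.bmGrowth σ := one_le_bmGrowth hU0 hV0 hσ
  have hQ0 : 0 ≤ P.bmGrowth σ := zero_le_one.trans hQ1
  have hL : Real.log (Real.exp 1 + |((0 : ℤ) : ℝ)|) = 1 := by simp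
  have hX0 : 0 ≤ t ^ 2 * (1 + t) * P.bmGrowth σ := by positivity
  have hA0 : 0 ≤ A := zero_le_one.trans hA1
  -- the threshold of `dist_limit_le` and `n ≥ 6k + 6`
  have hAX : A ≤ A * (1 + t ^ 2 * (1 + t) * P.bmGrowth σ) := by nlinarith
  have hkX : (6 * k + 2 : ℝ) ≤ (6 * k + 2) * (1 + t ^ 2 * (1 + t) * P.bmGrowth σ) := by nlinarith
  have hexp : (A + 6 * k + 2) * (1 + t ^ 2 * (1 + t) * P.bmGrowth σ) =
      A * (1 + t ^ 2 * (1 + t) * P.bmGrowth σ) + (6 * k + 2) * (1 + t ^ 2 * (1 + t) * P.bmGrowth σ) := by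
    ring
  rw [hexp] at hn
  have hn6 : (6 * k + 6 : ℝ) ≤ n := by linarith
  have hn6' : 6 * k + 6 ≤ n := by exact_mod_cast hn6
  have hkn : k ≤ n := by omega
  have hn' : 2 * ((k : ℕ) : ℝ) + 2 +
      A * (1 + t ^ 2 * (1 + t ^ (1 : ℝ)) * P.bmGrowth σ ^ (1 : ℝ)) ^ (1 / (2 - 1 : ℝ)) *
        Real.log (Real.exp 1 + |((0 : ℤ) : ℝ)|) ≤ n := by
    rw [hL, Real.rpow_one, Real.rpow_one, show (1 / (2 - 1 : ℝ)) = 1 by norm_num, Real.rpow_one]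
    linarith
  have hi : i ∈ Finset.Icc ((0 : ℤ) - (k : ℕ)) ((0 : ℤ) + (k : ℕ)) := by
    rw [Finset.mem_Icc]; omega
  obtain ⟨hq, hp⟩ := h σ hσ 0 t ht k n hn' i hi s hs
  rw [hL] at hp
  have hKQ : 0 ≤ t * (K * (2 * k + 9) * 32 ^ k) * P.bmGrowth σ := by positivity
  have h32 : (0 : ℝ) ≤ (1 / 32) ^ (n - 1) := by positivity
  have hη : P.bmGrowth σ ^ ((((max s₁ s₂ : ℕ) : ℝ) - 1) / ((max s₁ s₂ : ℕ) : ℝ)) ≤ P.bmGrowth σ :=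
    rpow_le_self_of_one_le hQ1 hη1.le
  have hη0 : 0 ≤ P.bmGrowth σ ^ ((((max s₁ s₂ : ℕ) : ℝ) - 1) / ((max s₁ s₂ : ℕ) : ℝ)) :=
    Real.rpow_nonneg hQ0 _
  refine ⟨hq.trans ?_, hp.trans ?_⟩
  · calc 2 * ((1 : ℝ) / 64) ^ (n + 1 - k) ≤ 2 * (1 / 32) ^ (n - 1) :=
          mul_le_mul_of_nonneg_left (one_div_pow_le_of_le hn6') (by norm_num)
      _ ≤ (2 + 22 * t * (K * (2 * k + 9) * 32 ^ k) * P.bmGrowth σ) * (1 / 32) ^ (n - 1) :=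
          mul_le_mul_of_nonneg_right (by linarith) h32
  · have e : 2 * (t * K * P.bmGrowth σ ^ ((((max s₁ s₂ : ℕ) : ℝ) - 1) / ((max s₁ s₂ : ℕ) : ℝ)) *
        (2 * k + 2 * 1 + 7) * (1 / 32) ^ (n - k)) =
        (2 * (2 * k + 9)) * (t * K) * P.bmGrowth σ ^ ((((max s₁ s₂ : ℕ) : ℝ) - 1) / ((max s₁ s₂ : ℕ) : ℝ)) *
          (1 / 32) ^ (n - k) := by ring
    rw [e]
    have htK : 0 ≤ (2 * (2 * k + 9)) * (t * K) := by positivity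
    have h32k : (0 : ℝ) ≤ 32 ^ k * (1 / 32) ^ (n - 1) := by positivity
    calc (2 * (2 * k + 9)) * (t * K) * P.bmGrowth σ ^ ((((max s₁ s₂ : ℕ) : ℝ) - 1) / ((max s₁ s₂ : ℕ) : ℝ)) *
          (1 / 32) ^ (n - k)
        ≤ (2 * (2 * k + 9)) * (t * K) * P.bmGrowth σ * (32 ^ k * (1 / 32) ^ (n - 1)) := by
          gcongr
          exact one_div_pow_sub_le k n hkn
      _ = (2 * t * (K * (2 * k + 9) * 32 ^ k) * P.bmGrowth σ) * (1 / 32) ^ (n - 1) := by ring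
      _ ≤ (2 + 22 * t * (K * (2 * k + 9) * 32 ^ k) * P.bmGrowth σ) * (1 / 32) ^ (n - 1) :=
          mul_le_mul_of_nonneg_right (by nlinarith) h32

/-- **Part F-L1 of stub F: fixed-time locality of a `𝒳₀`-dynamics, pointwise on `{Q ≤ N}`, for
observables reading a box.** Let `a` be an observable which is polynomially Lipschitz in the
coordinates at the sites of `[-k, k]` (hypothesis `ha`: if the coordinates of `σ'` there are bounded
by `R ≥ 1` and those of `σ` are within `δ ≤ 1` of them, then `|a σ - a σ'| ≤ C_a R^{d_a} δ`). There
are constants `A ≥ max(1, k)`, `K, L ≥ 0` such that for `N ≥ 1`, `σ ∈ 𝒳₀` with `Q(σ) ≤ N`, `t ≥ 0`,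
`n ≥ 4 + A(1 + t²(1+t)N)` with `δ_n := (2 + 22 t K N) 32^{-(n-1)} ≤ 1`, and `|s| ≤ t`:
`|a(φ_s σ) - a(T^{Λ_{0,n}}_s σ)| ≤ C_a (L N (2n + 7))^{d_a} δ_n` — the statement of the tree's
`InfiniteChainDynamics.exists_abs_sub_comp_severedFlow_le` with the sites `-1, 0, 1` replaced by
the box `[-k, k]` (same proof, fed with `exists_flow_sub_severedFlow_le_box`).
[cite: ButtaMarchioro2016, §3 eqs. (3.7), (3.14)–(3.16)] -/
theorem pencilFramework_localityA : ∀ (P : Literature.MathematicalPhysics.KineticTheory.HeatConduction.OscillatorChain) (s₁ s₂ : ℕ) (D : Literature.MathematicalPhysics.KineticTheory.HeatConduction.InfiniteChainDynamics P), 1 ≤ s₁ → 1 ≤ s₂ → Literature.MathematicalPhysics.KineticTheory.HeatConduction.OscillatorChain.IsEvenPolyOfDegree P.U s₁ → Literature.MathematicalPhysics.KineticTheory.HeatConduction.OscillatorChain.IsEvenPolyOfDegree P.V s₂ → D.carrier = P.bmGood → ∀ (hB1 : P.CondB1) (k : ℕ) (a : Literature.MathematicalPhysics.KineticTheory.HeatConduction.ChainConfig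 → ℝ) (Ca : ℝ) (da : ℕ), (∀ (σ σ' : Literature.MathematicalPhysics.KineticTheory.HeatConduction.ChainConfig) (R δ : ℝ), 1 ≤ R → 0 ≤ δ → δ ≤ 1 → (∀ i : ℤ, -(k : ℤ) ≤ i → i ≤ k → |(σ' i).1| ≤ R ∧ |(σ' i).2| ≤ R ∧ |(σ i).1 - (σ' i).1| ≤ δ ∧ |(σ i).2 - (σ' i).2| ≤ δ) → |a σ - a σ'| ≤ Ca * R ^ da * δ) → ∃ A K L : ℝ, 1 ≤ A ∧ (k : ℝ) ≤ A ∧ 0 ≤ K ∧ 0 ≤ L ∧ ∀ N : ℝ, 1 ≤ N → ∀ σ ∈ P.bmGood, P.bmGrowth σ ≤ N → ∀ t : ℝ, 0 ≤ t → ∀ n : ℕ, 4 + A * (1 + t ^ 2 * (1 + t) * N) ≤ n → (2 + 22 * t * K * N) * (1 / 32) ^ (n - 1) ≤ 1 → ∀ s : ℝ, |s| ≤ t → |a (D.flow s σ) - a (Literature.MathematicalPhysics.KineticTheory.HeatConduction.OscillatorChain.severedFlow hB1 (Finset.Icc ((0 : ℤ) - n) ((0 : ℤ) + n)) s σ)|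 ≤ Ca * (L * N * (2 * n + 7)) ^ da * ((2 + 22 * t * K * N) * (1 / 32) ^ (n - 1)) := by
  -- adapted from `InfiniteChainDynamics.exists_abs_sub_comp_severedFlow_le` (sites `-1,0,1` ↦ `[-k,k]`)
  intro P s₁ s₂ D hs₁ hs₂ hU1 hV1 hcar hB1 k a Ca da ha
  have hU : ContDiff ℝ 2 P.U := hU1.contDiff_two
  have hV : ContDiff ℝ 2 P.V := hV1.contDiff_two
  have hU0 : ∀ r, 0 ≤ P.U r := hU1.choose_spec.2.2
  have hV0 : ∀ r, 0 ≤ P.V r := hV1.choose_spec.2.2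
  have hVe : ∀ r, P.V (-r) = P.V r := fun r => congrFun hV1.comp_neg r
  obtain ⟨A, K, hAk, hK0, hrate⟩ := exists_flow_sub_severedFlow_le_box D hs₁ hs₂ hU1 hV1 hcar hB1 k
  obtain ⟨K₁, K₂, -, hK₂1, -, hposU, -, -, -⟩ := exists_constants hs₁ hs₂ hU1 hV1
  have hK₂0 : 0 ≤ K₂ := zero_le_one.trans hK₂1
  have hk0 : (0 : ℝ) ≤ k := Nat.cast_nonneg k
  have hA1 : 1 ≤ A := by linarith
  refine ⟨A, K, 2 * K₂, hA1, by linarith, hK0, by positivity, ?_⟩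
  intro N hN σ hσ hQN t ht n hn hδ1 s hs
  have hQ1 : 1 ≤ P.bmGrowth σ := one_le_bmGrowth hU0 hV0 hσ
  have hQ0 : 0 ≤ P.bmGrowth σ := zero_le_one.trans hQ1
  have hN0 : 0 ≤ N := zero_le_one.trans hN
  -- the rate hypothesis holds since `Q(σ) ≤ N`
  have hA0 : 0 ≤ A := zero_le_one.trans hA1
  have hnQ : 4 + A * (1 + t ^ 2 * (1 + t) * P.bmGrowth σ) ≤ n := by
    have h1 : t ^ 2 * (1 + t) * P.bmGrowth σ ≤ t ^ 2 * (1 + t) * N :=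
      mul_le_mul_of_nonneg_left hQN (by positivity)
    nlinarith
  set δ : ℝ := (2 + 22 * t * K * N) * (1 / 32) ^ (n - 1) with hδ
  have hδ0 : 0 ≤ δ := by positivity
  have hδQ : (2 + 22 * t * K * P.bmGrowth σ) * (1 / 32) ^ (n - 1) ≤ δ := by
    rw [hδ]
    refine mul_le_mul_of_nonneg_right ?_ (by positivity)
    have : t * K * P.bmGrowth σ ≤ t * K * N := mul_le_mul_of_nonneg_left hQN (by positivity)
    linarith
  -- the box `Λ_{0,n}` contains `[-k, k]`
  have hkn : k ≤ n := by
    have hX : A ≤ A * (1 + t ^ 2 * (1 + t) * N) := by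
      have : 0 ≤ t ^ 2 * (1 + t) * N := by positivity
      nlinarith
    have : (k : ℝ) ≤ n := by linarith
    exact_mod_cast this
  set Λ := Finset.Icc ((0 : ℤ) - n) ((0 : ℤ) + n) with hΛ
  set σ' : ChainConfig := severedFlow hB1 Λ s σ with hσ'
  -- energy bounds for `σ'` at the sites of `Λ`
  set Y := P.bmLocalEnergy 0 (n + 1) σ with hY
  have hY1 : 1 ≤ Y := one_le_bmLocalEnergy hU0 hV0 0 (n + 1) σ
  have hYN : Y ≤ N * (2 * n + 7) := by
    have h := bmLocalEnergy_le hU0 hV0 hσ 0 (n + 1)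
    have hL : Real.log (Real.exp 1 + |((0 : ℤ) : ℝ)|) = 1 := by simp
    rw [hL] at h
    push_cast at h
    have h2 : P.bmGrowth σ * (2 * (n + 1 : ℝ) + 2 * 1 + 3) ≤ N * (2 * n + 7) := by
      have : (0 : ℝ) ≤ 2 * (n + 1 : ℝ) + 2 * 1 + 3 := by positivity
      nlinarith
    exact h.trans h2
  set R : ℝ := 2 * K₂ * N * (2 * n + 7) with hR
  have h2YR : 2 * Y ≤ R := by
    have : 2 * Y ≤ 2 * (N * (2 * n + 7)) := by linarith
    have : N * (2 * n + 7) ≤ K₂ * N * (2 * n + 7) := by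
      have : 0 ≤ N * (2 * n + 7) := by positivity
      nlinarith
    rw [hR]; nlinarith
  have hR1 : 1 ≤ R := by
    have : 1 + |((σ' 0).1)| ≤ K₂ * Y := by
      refine hposU Y _ hY1 ?_
      have h0 : (0 : ℤ) ∈ Λ := by rw [hΛ, Finset.mem_Icc]; omega
      exact ((severedFlow_energy_bounds hU hV hU0 hV0 hB1 hVe 0 n σ s).1 0 h0).2
    have hKY : K₂ * Y ≤ R := by
      rw [hR]
      have : K₂ * Y ≤ K₂ * (N * (2 * n + 7)) := mul_le_mul_of_nonneg_left hYN hK₂0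
      have : 0 ≤ K₂ * (N * (2 * n + 7)) := by positivity
      nlinarith
    linarith [abs_nonneg ((σ' 0).1)]
  have hcoord : ∀ i : ℤ, -(k : ℤ) ≤ i → i ≤ k → |(σ' i).1| ≤ R ∧ |(σ' i).2| ≤ R ∧
      |(D.flow s σ i).1 - (σ' i).1| ≤ δ ∧ |(D.flow s σ i).2 - (σ' i).2| ≤ δ := by
    intro i hi1 hi2
    have hiΛ : i ∈ Λ := by
      rw [hΛ, Finset.mem_Icc]; omega
    obtain ⟨hp2, hUq⟩ := (severedFlow_energy_bounds hU hV hU0 hV0 hB1 hVe 0 n σ s).1 i hiΛ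
    obtain ⟨hq, hp⟩ := hrate σ hσ t ht n hnQ i hi1 hi2 s hs
    refine ⟨?_, ?_, hq.trans hδQ, hp.trans hδQ⟩
    · have h := hposU Y _ hY1 hUq
      have hKY : K₂ * Y ≤ R := by
        rw [hR]
        have : K₂ * Y ≤ K₂ * (N * (2 * n + 7)) := mul_le_mul_of_nonneg_left hYN hK₂0
        have : 0 ≤ K₂ * (N * (2 * n + 7)) := by positivity
        nlinarith
      linarith [abs_nonneg ((σ' i).1)]
    · exact (InfiniteChainDynamics.abs_le_two_mul_of_sq_half_le hY1 hp2).trans h2YR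
  have key := ha (D.flow s σ) σ' R δ hR1 hδ0 hδ1 hcoord
  have e : R = 2 * K₂ * N * (2 * n + 7) := hR
  calc |a (D.flow s σ) - a σ'| ≤ Ca * R ^ da * δ := key
    _ = Ca * (2 * K₂ * N * (2 * n + 7)) ^ da * ((2 + 22 * t * K * N) * (1 / 32) ^ (n - 1)) := by
        rw [e, hδ]

end Summit.AtomisticToContinuum.FouriersLaw.Theorems.DrudeDissolution.GramPencilHarmonicChaos

end
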